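import Literature.NumberTheory.EllipticCurves.NewformPadicIntegralModel
import Literature.NumberTheory.GaloisRepresentations.FrobeniusDivisionDensityProofs
import Literature.NumberTheory.GaloisRepresentations.CyclotomicCharacterFrobeniusProofs
import Literature.NumberTheory.GaloisRepresentations.HeckeCharacterProofs
import Mathlib.LinearAlgebra.Charpoly.BaseChange
import HarnessLib

/-!
# `det ρ = ε` for a rank-two framed `𝒪`-representation with Frobenius polynomials `X² − a_ℓ X + ℓ` (STUB-PLAN rev 9, helper (ν) / S21)

Route `ResidualThetaTransportAtTwo` (RTT), crux RSL_g `ResidualSignedLambdaLowerCMAtTwo` (stmt-BirchSwinnertonDyer-22608); seat `prover-bsd-wall-rtt-p2` g16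
(`--supports`, closes nothing). THEOREMS ONLY. The crux binder `hρ` records, at every `v ∤ 2M`, a Frobenius characteristic polynomial of
`ρ : Γ_ℚ → GL₂(𝒪)` of the shape `X² − a_ℓ X + ℓ`. Consequence proved here, in kernel (no Chebotarev: the tree's UNCONDITIONAL
`absoluteGaloisGroup.monoidHom_eq_of_frobenius'`, from Frobenius' density theorem): the determinant character of `ρ` IS the `p`-adic
cyclotomic character, `det ρ(σ) = ε(σ)` for EVERY `σ ∈ Γ_ℚ` (compared inside `ℚ̄_p`, where both `𝒪 ⊂ ℚ̄_p` and `ℤ_p ⊂ ℚ_p ⊂ ℚ̄_p` live).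
This is the hypothesis under which the alternating form `T_ρ × T_ρ → 𝒪(1)` is `Γ_ℚ`-equivariant, i.e. the self-duality `A_ρ ≅ T_ρ^∨(1)` feeding
the `ρ`-coefficient local Tate pairings of PIN-SPEC-S2 (the datum `ePk` of `CyclotomicLayer.rhoLayerPairingPk`). BSD is not proved by any of this.

* `det_toGaloisRep_eq` — `LinearMap.det (ρ σ) = det (ρ σ)` (the linear map on `𝒪²` is the matrix).
* `det_eq_coeff_zero_of_hasFrobCharpolyAt` — at an arithmetic Frobenius with characteristic polynomial `P`: `det ρ(Φ) = P.coeff 0`.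
* **`det_eq_cyclotomicCharacter_of_hasFrobCharpolyAt`** — `T` finite containing the places above `p`, `P_v.coeff 0 = ℓ_v` off `T` ⟹ `det ρ = ε`.
* **`det_eq_cyclotomicCharacter_of_frobCharpoly_shape`** — the same from the crux's binder shape (`P.map 𝒪.subtype = X² − C a X + C ℓ` off `2M`).

References: [DarmonDiamondTaylor1995] Thm. 3.1 (d); [Ribet1977] Prop. (2.2); [SerreAbelianLadic1968] Ch. I §1.2, §2.3; [Marcus2018] Ch. 7 Ex. 12 (f).
-/

set_option autoImplicit false
-- the Theorems namespace of this sub repeats the summit name by design (D-0017 nested layout)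
set_option linter.dupNamespace false

noncomputable section

open scoped Classical

namespace Summit.BirchSwinnertonDyer.BirchSwinnertonDyer.Theorems.ThetaTransport

open NumberField Field IsDedekindDomain Polynomial Literature.NumberTheory.EllipticCurves
  Literature.NumberTheory.GaloisRepresentations Rat.HeightOneSpectrum

variable {p : ℕ} [Fact p.Prime] (S : Set (PadicAlgCl p)) {n : ℕ}

/-- The linear map `ρ(σ)` on `𝒪ⁿ` underlying a framed representation has determinant `det ρ(σ)`. [folklore] [cite: SerreAbelianLadic1968, Ch. I §1.1] -/
theorem det_toGaloisRep_eq (ρ : FramedGaloisRep ℚ ↥(padicCoeffIntegers S) n) (σ : absoluteGaloisGroup ℚ) :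
    LinearMap.det (ρ.toGaloisRep σ : (Fin n → ↥(padicCoeffIntegers S)) →ₗ[↥(padicCoeffIntegers S)] (Fin n → ↥(padicCoeffIntegers S))) =
      ((FramedRep.det ρ σ : (↥(padicCoeffIntegers S))ˣ) : ↥(padicCoeffIntegers S)) := by
  have h : (ρ.toGaloisRep σ : (Fin n → ↥(padicCoeffIntegers S)) →ₗ[↥(padicCoeffIntegers S)] (Fin n → ↥(padicCoeffIntegers S))) =
      Matrix.toLin' ((ρ σ : GL (Fin n) ↥(padicCoeffIntegers S)) : Matrix (Fin n) (Fin n) ↥(padicCoeffIntegers S)) := by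
    refine LinearMap.ext fun w ↦ ?_
    rw [Matrix.toLin'_apply]
    rfl
  rw [h, LinearMap.det_toLin', FramedRep.det_apply, Matrix.GeneralLinearGroup.val_det_apply]

/-- At an arithmetic Frobenius `Φ` above `v` with `ρ.HasFrobCharpolyAt v P` (rank two): `det ρ(Φ) = P(0)`
(`det = (−1)^2 ·` constant coefficient of the characteristic polynomial). [cite: SerreAbelianLadic1968, Ch. I §2.3] -/
theorem det_eq_coeff_zero_of_hasFrobCharpolyAt (ρ : FramedGaloisRep ℚ ↥(padicCoeffIntegers S) 2)
    {v : HeightOneSpectrum (𝓞 ℚ)} {P : Polynomial ↥(padicCoeffIntegers S)} (hP : ρ.toGaloisRep.HasFrobCharpolyAt v P)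
    {𝔓 : Ideal (absIntegers (𝓞 ℚ) ℚ)} (h𝔓 : 𝔓 ∈ v.primesAbove) {Φ : absoluteGaloisGroup ℚ} (hΦ : IsArithFrobAt (𝓞 ℚ) Φ 𝔓) :
    ((FramedRep.det ρ Φ : (↥(padicCoeffIntegers S))ˣ) : ↥(padicCoeffIntegers S)) = P.coeff 0 := by
  rw [← det_toGaloisRep_eq, LinearMap.det_eq_sign_charpoly_coeff, hP 𝔓 h𝔓 Φ hΦ, Module.finrank_fin_fun]
  ring

/-- **`det ρ = ε`.** Let `ρ : Γ_ℚ → GL₂(𝒪)` be a framed representation (`𝒪 = padicCoeffIntegers S ⊂ ℚ̄_p`), `T` a finite set of places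
containing those above `p`, and suppose that at every `v ∉ T` some characteristic polynomial of the arithmetic Frobenii has constant
coefficient `ℓ_v = natGenerator v`. Then `det ρ(σ) = ε_p(σ)` in `ℚ̄_p` for every `σ ∈ Γ_ℚ`. Proof: both sides are continuous characters
agreeing at the arithmetic Frobenii off `T` (`det ρ(Φ_v) = ℓ_v`, `ε(Φ_v) = N v = ℓ_v`), hence equal by the tree's unconditional
`absoluteGaloisGroup.monoidHom_eq_of_frobenius'`. [cite: DarmonDiamondTaylor1995, Thm. 3.1 (d)] [cite: Ribet1977, Prop. (2.2)]
[cite: SerreAbelianLadic1968, Ch. I §1.2 and §2.3] -/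
theorem det_eq_cyclotomicCharacter_of_hasFrobCharpolyAt (ρ : FramedGaloisRep ℚ ↥(padicCoeffIntegers S) 2)
    (T : Set (HeightOneSpectrum (𝓞 ℚ))) (hT : T.Finite) (hpT : ∀ v : HeightOneSpectrum (𝓞 ℚ), ((p : ℕ) : 𝓞 ℚ) ∈ v.asIdeal → v ∈ T)
    (hρ : ∀ v ∉ T, ∃ P : Polynomial ↥(padicCoeffIntegers S),
      ρ.toGaloisRep.HasFrobCharpolyAt v P ∧ P.coeff 0 = ((natGenerator v : ℕ) : ↥(padicCoeffIntegers S)))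
    (σ : absoluteGaloisGroup ℚ) :
    (((FramedRep.det ρ σ : (↥(padicCoeffIntegers S))ˣ) : ↥(padicCoeffIntegers S)) : PadicAlgCl p) =
      algebraMap ℚ_[p] (PadicAlgCl p) (((GaloisRep.cyclotomicCharacter ℚ p σ : ℤ_[p]ˣ) : ℤ_[p]) : ℚ_[p]) := by
  -- the two characters `Γ_ℚ →* ℚ̄_pˣ`
  let χ₁ : absoluteGaloisGroup ℚ →* (PadicAlgCl p)ˣ :=
    (Units.map ((padicCoeffIntegers S).subtype : ↥(padicCoeffIntegers S) →* PadicAlgCl p)).comp (FramedRep.det ρ).toMonoidHom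
  let χ₂ : absoluteGaloisGroup ℚ →* (PadicAlgCl p)ˣ :=
    (Units.map (((algebraMap ℚ_[p] (PadicAlgCl p)).comp (PadicInt.Coe.ringHom (p := p))) : ℤ_[p] →* PadicAlgCl p)).comp
      (GaloisRep.cyclotomicCharacter ℚ p).toMonoidHom
  have h₁ : Continuous (Units.val ∘ χ₁) :=
    continuous_subtype_val.comp (Units.continuous_val.comp (FramedRep.det ρ).continuous)
  have h₂ : Continuous (Units.val ∘ χ₂) := by
    have hc : Continuous fun x : ℤ_[p] ↦ algebraMap ℚ_[p] (PadicAlgCl p) (x : ℚ_[p]) :=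
      (continuous_algebraMap ℚ_[p] (PadicAlgCl p)).comp continuous_subtype_val
    exact hc.comp (Units.continuous_val.comp (GaloisRep.cyclotomicCharacter ℚ p).continuous)
  have hS : (T ∪ {v : HeightOneSpectrum (𝓞 ℚ) | ((p : ℕ) : 𝓞 ℚ) ∈ v.asIdeal}).Finite :=
    hT.union (hT.subset fun v hv ↦ hpT v hv)
  have heq : χ₁ = χ₂ := by
    refine absoluteGaloisGroup.monoidHom_eq_of_frobenius' Units.val_injective hS h₁ h₂ fun v hv 𝔓 h𝔓 Φ hΦ ↦ ?_
    simp only [Set.mem_union, Set.mem_setOf_eq, not_or] at hv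
    obtain ⟨P, hP, hP0⟩ := hρ v hv.1
    apply Units.val_injective
    change (((FramedRep.det ρ Φ : (↥(padicCoeffIntegers S))ˣ) : ↥(padicCoeffIntegers S)) : PadicAlgCl p) =
      algebraMap ℚ_[p] (PadicAlgCl p) (((GaloisRep.cyclotomicCharacter ℚ p Φ : ℤ_[p]ˣ) : ℤ_[p]) : ℚ_[p])
    rw [det_eq_coeff_zero_of_hasFrobCharpolyAt S ρ hP h𝔓 hΦ, hP0,
      GaloisRep.cyclotomicCharacter_apply_of_isArithFrobAt hv.2 h𝔓 hΦ, Rat.residueCard_eq_natGenerator]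
    simp
  have := DFunLike.congr_fun heq σ
  simpa [χ₁, χ₂] using congrArg Units.val this

/-- **`det ρ = ε` from the crux's binder shape.** In RSL_g the datum `hρ` gives, at every `v` with `ℓ_v ∤ 2M`, a polynomial `P ∈ 𝒪[X]` with
`P ↦ X² − a_ℓ X + ℓ` in `ℚ̄_p[X]` and `ρ.HasFrobCharpolyAt v P`; for `p = 2` (so that the places above `p` divide `2M`) and `M ≠ 0` this gives
`det ρ(σ) = ε₂(σ)` for every `σ`. [cite: DarmonDiamondTaylor1995, Thm. 3.1 (d)] [cite: Ribet1977, Prop. (2.2)] -/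
theorem det_eq_cyclotomicCharacter_of_frobCharpoly_shape (S : Set (PadicAlgCl 2)) (ρ : FramedGaloisRep ℚ ↥(padicCoeffIntegers S) 2)
    {M : ℕ} (hM : M ≠ 0) (a : HeightOneSpectrum (𝓞 ℚ) → PadicAlgCl 2)
    (hρ : ∀ v : HeightOneSpectrum (𝓞 ℚ), ¬ natGenerator v ∣ 2 * M →
      ∃ P : Polynomial ↥(padicCoeffIntegers S), P.map (padicCoeffIntegers S).subtype =
        X ^ 2 - C (a v) * X + C ((natGenerator v : ℕ) : PadicAlgCl 2) ∧ ρ.toGaloisRep.HasFrobCharpolyAt v P)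
    (σ : absoluteGaloisGroup ℚ) :
    (((FramedRep.det ρ σ : (↥(padicCoeffIntegers S))ˣ) : ↥(padicCoeffIntegers S)) : PadicAlgCl 2) =
      algebraMap ℚ_[2] (PadicAlgCl 2) (((GaloisRep.cyclotomicCharacter ℚ 2 σ : ℤ_[2]ˣ) : ℤ_[2]) : ℚ_[2]) := by
  refine det_eq_cyclotomicCharacter_of_hasFrobCharpolyAt S ρ {v | natGenerator v ∣ 2 * M} ?_ ?_ ?_ σ
  · -- finitely many places divide `2M`
    have h := Ideal.finite_factors (I := Ideal.span {((2 * M : ℕ) : 𝓞 ℚ)}) (by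
      rw [Ne, Ideal.zero_eq_bot, Ideal.span_singleton_eq_bot]
      exact_mod_cast mul_ne_zero two_ne_zero hM)
    exact h.subset fun v hv ↦ Ideal.dvd_span_singleton.mpr ((Rat.natCast_mem_asIdeal_iff v).mpr hv)
  · intro v hv
    exact dvd_mul_of_dvd_left ((Rat.natCast_mem_asIdeal_iff v).mp hv) M
  · intro v hv
    obtain ⟨P, hPmap, hP⟩ := hρ v hv
    refine ⟨P, hP, Subtype.ext ?_⟩
    have h0 := congrArg (fun Q : Polynomial (PadicAlgCl 2) ↦ Q.coeff 0) hPmap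
    simp only [coeff_map, coeff_add, coeff_sub, coeff_C_zero, coeff_X_pow, coeff_C_mul, coeff_X_zero, mul_zero, sub_zero] at h0
    simpa using h0

end Summit.BirchSwinnertonDyer.BirchSwinnertonDyer.Theorems.ThetaTransport

end
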